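import Summits.CriticalPhenomena.PercolationContinuityZ3.Theorems.Transplant.FKConnectivityAllQForestHubPairDoublePair
import Summits.CriticalPhenomena.PercolationContinuityZ3.Theorems.Transplant.FKConnectivityAllQForestHubPairOneClassIdentities
import Summits.CriticalPhenomena.PercolationContinuityZ3.Theorems.Transplant.FKConnectivityAllQForestHubPairDecomposition
import HarnessLib

/-!
# Three more pieces of the absorption architecture: DOUBLE pairs halve `bad` and `good`, TRIPLE quotient-parallel pairs empty the fibre,
# and the PENDANT-CLASS reduction of one-class hub-pair positivity (★) to the node of a smaller fibre ("M2")

Support file (`--supports stmt-CriticalPhenomena-4575`), FK sub-lane `prim-bschramm-fk-1` (gen 26) of the post-continuity programme;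
builds on p205010 (kernel theorem, internal audit signed; external expert review pending).  No definitions, no named facts, no sorries;
standard axioms.

Setting as in `…ForestHubPairDecomposition` (g25): fibre `(M, u₀)`, hub `o`, `e = ov`, `f = oy`; `bad = #(Fo ∩ {e,f}, Fo)`,
`good = #(Fo ∩ {e}, Fo ∩ {f})`; the one-class (type-A) counts at `(o, a)`: `sRR = #(Fo∩{e,f}∩R_oa, Fo∩R_oaᶜ)`, `sBB = #(Fo∩R_oa, Fo∩{e,f}∩R_oaᶜ)`,
`dRB = #(Fo∩{e}∩R_oa, Fo∩{f}∩R_oaᶜ)`, `dBR = #(Fo∩{f}∩R_oa, Fo∩{e}∩R_oaᶜ)`; (★) is `sRR + sBB ≤ dRB + dBR`.  The assembly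
"absorption monotonicity ⇒ node" of memo bschramm/FROM-fk-1-g25-HUB-PAIR-DECOMPOSITION.md §6f needs, besides the landed identities
F1/F2/F3/F4d/F6 and the class-form diamond (`…ForestPairSlide`, g26), the following three facts, proved here:
* **`adjForestNoSq_counts_eq_two_mul_of_quotParallel`** — two free pairs `h, h' ∉ {e,f}` parallel in the quotient: `bad(M,u₀) = 2·bad(M∖{h,h'}, u₀+h)`
  and `good(M,u₀) = 2·good(M∖{h,h'}, u₀+h)` (corollary of g25's `fibreCount_eq_two_mul_of_quotParallel`);
* **`fibreCount_forest_eq_zero_of_three_quotParallel`** — three distinct free pairs pairwise parallel in the quotient: every forest fibre count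
  vanishes (two of them lie in one class: `not_both_of_quotParallel`);
* **`hubPairOneClass_of_pendantClass`** ("M2") — if the pinned class `[a]` (`≠ [o], [v], [y]`) meets exactly ONE free pair `g = s(a₁, v₁)`, joining it
  to `[v]`, then (★) at `(o, a)` on `(N, u)` follows from the node `bad ≤ good` of the smaller fibre `(N ∖ g, u)`: deleting `g` identifies the
  type-A(o,a) counts with the "`v ∈ C_first(o)`"-restricted counts of `(N ∖ g, u)` (`pendantClass_count_eq`), which split into the type-A(o,v) part
  (an equality, F3 `hubPair_sRR_eq_dRB_at_v` / `hubPair_second_e_eq_zero_at_v`) and the type-AB(o,v) part (bounded by the node after the swap).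
[cite: SempleWelsh2008, Conj. 1.1 (p. 2); Thm. 4.2 (p. 11)] [cite: Linusson2011, Prop. 2.6] [cite: Grimmett2006, §1.5 (p. 13)]
-/

noncomputable section

namespace Summit.CriticalPhenomena.PercolationContinuityZ3.Theorems
namespace FK

open Set Literature.Probability.LatticeModels Literature.Probability.Percolation
open scoped Classical symmDiff

variable {V : Type*} [Fintype V]

/-! ### Double pairs halve `bad` and `good` -/

section Double

variable {M u₀ : BondConfig V} {o v y a₁ z₁ a₂ z₂ : V}

/-- **Two quotient-parallel free pairs `h = s(a₁,z₁)`, `h' = s(a₂,z₂) ∉ {e, f}` halve `bad` and `good`**: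
`#_{(M,u₀)}(Fo ∩ P₀, Fo ∩ Q₀) = 2·#_{(M∖{h,h'}, u₀+h)}(Fo ∩ P₀, Fo ∩ Q₀)` for the membership events `P₀, Q₀` of `e, f`.
[cite: SempleWelsh2008, Conj. 1.1 (p. 2)] [cite: Linusson2011, Prop. 2.6] -/
theorem adjForestNoSq_counts_eq_two_mul_of_quotParallel (hd : Disjoint u₀ M)
    (hhM : s(a₁, z₁) ∈ M) (hh'M : s(a₂, z₂) ∈ M) (hne : s(a₂, z₂) ≠ s(a₁, z₁))
    (ha : (openGraph u₀).Reachable a₁ a₂) (hz : (openGraph u₀).Reachable z₁ z₂) (h1 : a₁ ≠ z₁) (h2 : a₂ ≠ z₂)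
    (he1 : s(a₁, z₁) ≠ s(o, v)) (he2 : s(a₂, z₂) ≠ s(o, v)) (hf1 : s(a₁, z₁) ≠ s(o, y)) (hf2 : s(a₂, z₂) ≠ s(o, y))
    (P₀ Q₀ : Set (BondConfig V))
    (hP₀ : P₀ ∈ ({univ, {ω | s(o, v) ∈ ω}, {ω | s(o, y) ∈ ω}, {ω | s(o, v) ∈ ω ∧ s(o, y) ∈ ω}} : Set (Set (BondConfig V))))
    (hQ₀ : Q₀ ∈ ({univ, {ω | s(o, v) ∈ ω}, {ω | s(o, y) ∈ ω}, {ω | s(o, v) ∈ ω ∧ s(o, y) ∈ ω}} : Set (Set (BondConfig V)))) :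
    fibreCount M u₀ (forestEv V ∩ P₀) (forestEv V ∩ Q₀) =
      2 * fibreCount (M \ {s(a₁, z₁), s(a₂, z₂)}) (insert s(a₁, z₁) u₀) (forestEv V ∩ P₀) (forestEv V ∩ Q₀) := by
  have hu : s(a₁, z₁) ∉ u₀ := fun hx => hd.le_bot ⟨hx, hhM⟩
  have hu' : s(a₂, z₂) ∉ u₀ := fun hx => hd.le_bot ⟨hx, hh'M⟩
  have memInv : ∀ R₀ ∈ ({univ, {ω | s(o, v) ∈ ω}, {ω | s(o, y) ∈ ω}, {ω | s(o, v) ∈ ω ∧ s(o, y) ∈ ω}} : Set (Set (BondConfig V))),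
      ∀ (β : BondConfig V) (g g' : Sym2 V), g ≠ s(o, v) → g ≠ s(o, y) → g' ≠ s(o, v) → g' ≠ s(o, y) →
        (β ∈ R₀ → insert g (β \ {g'}) ∈ R₀) := by
    intro R₀ hR₀ β g g' hg1 hg2 hg'1 hg'2 hβ
    have hev : s(o, v) ∈ β → s(o, v) ∈ insert g (β \ {g'}) := fun hx => mem_insert_of_mem _ ⟨hx, fun hx' => hg'1 (mem_singleton_iff.1 hx').symm⟩
    have hfv : s(o, y) ∈ β → s(o, y) ∈ insert g (β \ {g'}) := fun hx => mem_insert_of_mem _ ⟨hx, fun hx' => hg'2 (mem_singleton_iff.1 hx').symm⟩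
    simp only [mem_insert_iff, mem_singleton_iff] at hR₀
    rcases hR₀ with rfl | rfl | rfl | rfl
    · exact mem_univ _
    · exact hev hβ
    · exact hfv hβ
    · exact ⟨hev hβ.1, hfv hβ.2⟩
  refine fibreCount_eq_two_mul_of_quotParallel hd hhM hh'M hne ha hz h1 h2 (fun ω hω => hω.1) (fun ω hω => hω.1)
    (fun β hβ hin hout hP => ?_) (fun β hβ hin hout hP => ?_) (fun β hβ hin hout hQ => ?_) (fun β hβ hin hout hQ => ?_)
  · exact ⟨isForestCfg_exchange_quotParallel hβ hP.1 ha hz h1 h2 hu' hout hin, memInv P₀ hP₀ β _ _ he1 hf1 he2 hf2 hP.2⟩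
  · exact ⟨isForestCfg_exchange_quotParallel (a₁ := a₂) (z₁ := z₂) (a₂ := a₁) (z₂ := z₁) hβ hP.1 ha.symm hz.symm h2 h1 hu hout hin,
      memInv P₀ hP₀ β _ _ he2 hf2 he1 hf1 hP.2⟩
  · exact ⟨isForestCfg_exchange_quotParallel hβ hQ.1 ha hz h1 h2 hu' hout hin, memInv Q₀ hQ₀ β _ _ he1 hf1 he2 hf2 hQ.2⟩
  · exact ⟨isForestCfg_exchange_quotParallel (a₁ := a₂) (z₁ := z₂) (a₂ := a₁) (z₂ := z₁) hβ hQ.1 ha.symm hz.symm h2 h1 hu hout hin,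
      memInv Q₀ hQ₀ β _ _ he2 hf2 he1 hf1 hQ.2⟩

end Double

/-! ### Triple quotient-parallel pairs empty the fibre -/

section Triple

variable {M u₀ : BondConfig V} {a₁ z₁ a₂ z₂ a₃ z₃ : V}

/-- **Three distinct free pairs pairwise parallel in the quotient leave no forest colouring**: two of them lie in the same class, where
together with the pinned detours they close a cycle.  Every forest fibre count of `(M, u₀)` vanishes. [cite: Grimmett2006, §1.5 (p. 13)]
[cite: Linusson2011, Prop. 2.6] -/
theorem fibreCount_forest_eq_zero_of_three_quotParallel (hd : Disjoint u₀ M)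
    (h₁M : s(a₁, z₁) ∈ M) (h₂M : s(a₂, z₂) ∈ M) (h₃M : s(a₃, z₃) ∈ M)
    (h12 : s(a₁, z₁) ≠ s(a₂, z₂)) (h13 : s(a₁, z₁) ≠ s(a₃, z₃)) (h23 : s(a₂, z₂) ≠ s(a₃, z₃))
    (ha₂ : (openGraph u₀).Reachable a₁ a₂) (ha₃ : (openGraph u₀).Reachable a₁ a₃)
    (hz₂ : (openGraph u₀).Reachable z₁ z₂) (hz₃ : (openGraph u₀).Reachable z₁ z₃)
    (hn₁ : a₁ ≠ z₁) (hn₂ : a₂ ≠ z₂) (hn₃ : a₃ ≠ z₃) (P Q : Set (BondConfig V)) :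
    fibreCount M u₀ (forestEv V ∩ P) (forestEv V ∩ Q) = 0 := by
  have hu₁ : s(a₁, z₁) ∉ u₀ := fun hx => hd.le_bot ⟨hx, h₁M⟩
  have hu₂ : s(a₂, z₂) ∉ u₀ := fun hx => hd.le_bot ⟨hx, h₂M⟩
  have hu₃ : s(a₃, z₃) ∉ u₀ := fun hx => hd.le_bot ⟨hx, h₃M⟩
  refine fibreCount_eq_zero_of_forall _ _ _ _ fun ω hω hA hB => ?_
  have hsub : u₀ ⊆ ω := fun r hr => (show r ∈ ω \ M by rw [hω]; exact hr).1
  have hsub' : u₀ ⊆ ω ∆ M := fun r hr => Set.mem_symmDiff.2 (Or.inl ⟨hsub hr, fun hrM => hd.le_bot ⟨hr, hrM⟩⟩)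
  have free : ∀ {g : Sym2 V}, g ∈ M → g ∉ ω → g ∈ ω ∆ M := fun hgM hg => Set.mem_symmDiff.2 (Or.inr ⟨hgM, hg⟩)
  -- in the first class at most one of the three; likewise in the second
  by_cases h1 : s(a₁, z₁) ∈ ω
  · have h2 : s(a₂, z₂) ∉ ω := not_both_of_quotParallel hsub hA.1 ha₂ hz₂ hn₁ hn₂ h12.symm hu₂ h1
    have h3 : s(a₃, z₃) ∉ ω := not_both_of_quotParallel hsub hA.1 ha₃ hz₃ hn₁ hn₃ h13.symm hu₃ h1
    exact not_both_of_quotParallel (a₁ := a₂) (z₁ := z₂) (a₂ := a₃) (z₂ := z₃) hsub' hB.1 (ha₂.symm.trans ha₃) (hz₂.symm.trans hz₃)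
      hn₂ hn₃ h23.symm hu₃ (free h₂M h2) (free h₃M h3)
  · by_cases h2 : s(a₂, z₂) ∈ ω
    · have h3 : s(a₃, z₃) ∉ ω := not_both_of_quotParallel (a₁ := a₂) (z₁ := z₂) (a₂ := a₃) (z₂ := z₃) hsub hA.1
        (ha₂.symm.trans ha₃) (hz₂.symm.trans hz₃) hn₂ hn₃ h23.symm hu₃ h2
      exact not_both_of_quotParallel hsub' hB.1 ha₃ hz₃ hn₁ hn₃ h13.symm hu₃ (free h₁M h1) (free h₃M h3)
    · exact not_both_of_quotParallel hsub' hB.1 ha₂ hz₂ hn₁ hn₂ h12.symm hu₂ (free h₁M h1) (free h₂M h2)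

end Triple

/-! ### M2: the pendant-class reduction -/

section Pendant

variable {N u : BondConfig V} {o v y a a₁ v₁ : V}

/-- **Deleting the only free pair at a pendant class.**  If `g = s(a₁, v₁)` (`a₁ ∈ [a]`, `v₁ ∈ [v]`, `[a] ≠ [v]`, `[a] ≠ [o]`) is the only free
pair meeting the pinned class `[a]`, then for first-class events `P` depending only on pairs other than `g` and all second-class events `Q`:
`#_{(N,u)}(Fo ∩ P ∩ R_oa, Fo ∩ Q ∩ R_oaᶜ) = #_{(N∖g,u)}(Fo ∩ P ∩ R_ov, Fo ∩ Q)` — the type-A(o,a) colourings are "`g` first, `v ∈ C_first(o)`".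
[cite: Linusson2011, Prop. 2.6] [cite: Grimmett2006, §1.5 (p. 13)] -/
theorem pendantClass_count_eq (hd : Disjoint u N) (hgN : s(a₁, v₁) ∈ N) (ha₁ : (openGraph u).Reachable a a₁)
    (hv₁ : (openGraph u).Reachable v v₁) (hav : ¬ (openGraph u).Reachable a v) (hao : ¬ (openGraph u).Reachable a o)
    (honly : ∀ p ∈ N, ∀ z ∈ p, (openGraph u).Reachable a z → p = s(a₁, v₁))
    {P : Set (BondConfig V)} (Q : Set (BondConfig V)) (hP : ∀ ω : BondConfig V, s(a₁, v₁) ∉ ω → (insert s(a₁, v₁) ω ∈ P ↔ ω ∈ P)) :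
    fibreCount N u (forestEv V ∩ P ∩ reachEv o a) (forestEv V ∩ Q ∩ (reachEv o a)ᶜ) =
      fibreCount (N \ {s(a₁, v₁)}) u (forestEv V ∩ P ∩ reachEv o v) (forestEv V ∩ Q) := by
  set g := s(a₁, v₁) with hgdef
  have hav₁ : a₁ ≠ v₁ := fun h => hav ((ha₁.trans (h ▸ hv₁.symm)))
  set N' := N \ {g} with hN'
  have hgN' : g ∉ N' := fun h => h.2 rfl
  have hgu : g ∉ u := fun h => hd.le_bot ⟨h, hgN⟩
  have hNN : N = insert g N' := by rw [hN', insert_sdiff_singleton, insert_eq_of_mem hgN]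
  -- KEY: in a configuration `β ⊇ u` of pairs from `N' ∪ u`, the class `[a]` is closed: `a` reaches only `[a]`
  have closed : ∀ β : BondConfig V, u ⊆ β → β ⊆ N' ∪ u → ∀ z, (openGraph β).Reachable a z → (openGraph u).Reachable a z := by
    intro β hsub hβ z hz
    refine reachable_pinned_of_closed (o := a) (fun p hp hpd w hw haw => ?_) hz
    rcases hβ hp with hp' | hp'
    · exact absurd (honly p hp'.1 w hw haw) fun h => hp'.2 (mem_singleton_iff.2 h)
    · exact hp'
  rw [hNN, fibreCount_insert_one hgN']
  -- the summand with `g` in the second class vanishes: `a` cannot reach `o` in a first class avoiding `g`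
  have h0 : fibreCount N' u ({ω | g ∉ ω} ∩ (forestEv V ∩ P ∩ reachEv o a)) ({ω | g ∉ ω} ∩ {ω | insert g ω ∈ forestEv V ∩ Q ∩ (reachEv o a)ᶜ}) = 0 := by
    refine fibreCount_eq_zero_of_forall _ _ _ _ fun ω hω hA _ => hao ?_
    have hsub : u ⊆ ω := fun r hr => (show r ∈ ω \ N' by rw [hω]; exact hr).1
    exact closed ω hsub (subset_union_of_fibre hω).1 o hA.2.2.symm
  rw [h0, add_zero]
  refine fibreCount_congr_fibre N' u fun ω hω => ?_
  have hno := notMem_and_notMem_symmDiff_of_fibre hgN' hgu hω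
  have hsub : u ⊆ ω := fun r hr => (show r ∈ ω \ N' by rw [hω]; exact hr).1
  have hsub' : u ⊆ ω ∆ N' := fun r hr => Set.mem_symmDiff.2 (Or.inl ⟨hsub hr, fun hrN => (hd.mono_right sdiff_subset).le_bot ⟨hr, hrN⟩⟩)
  have hωN : ω ⊆ N' ∪ u := (subset_union_of_fibre hω).1
  have hωN' : ω ∆ N' ⊆ N' ∪ u := (subset_union_of_fibre hω).2
  -- `a₁ ≁ v₁` in `ω` (the class of `a` is closed and misses `v₁`)
  have hsep : ¬ (openGraph ω).Reachable a₁ v₁ := fun h =>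
    hav ((closed ω hsub hωN v₁ ((ha₁.mono (openGraph_mono hsub)).trans h)).trans hv₁.symm)
  have hFins := insert_mem_forestEv_iff hav₁ hno.1 (V := V)
  -- reachability of `a` from `o` in `insert g ω` ⟺ `v ∈ C_ω(o)`
  have hreach : (openGraph (insert g ω)).Reachable o a ↔ (openGraph ω).Reachable o v := by
    constructor
    · intro h
      -- a walk from `o` to `a` in `ω ∪ {g}` leaves the `ω`-cluster of `o` through `g`
      by_contra hov
      obtain ⟨W⟩ := h
      have hoS : o ∈ {z | (openGraph ω).Reachable o z} := SimpleGraph.Reachable.refl _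
      have haS : a ∉ {z | (openGraph ω).Reachable o z} := fun h' => hao (closed ω hsub hωN o h'.symm)
      obtain ⟨d, -, hd1, hd2⟩ := W.exists_boundary_dart {z | (openGraph ω).Reachable o z} hoS haS
      simp only [mem_setOf_eq] at hd1 hd2
      have hadj := (openGraph_adj (insert g ω) d.fst d.snd).1 d.adj
      rcases mem_insert_iff.1 hadj.1 with hdg | hdω
      · rcases Sym2.eq_iff.1 hdg with ⟨h1, -⟩ | ⟨h1, -⟩
        · exact hao (closed ω hsub hωN o ((ha₁.mono (openGraph_mono hsub)).trans (h1 ▸ hd1).symm))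
        · exact hov (hd1.trans (h1 ▸ (hv₁.mono (openGraph_mono hsub)).symm))
      · exact hd2 (hd1.trans ((openGraph_adj ω d.fst d.snd).2 ⟨hdω, hadj.2⟩).reachable)
    · intro h
      have h1 : (openGraph (insert g ω)).Reachable o v₁ := (h.trans (hv₁.mono (openGraph_mono hsub))).mono (openGraph_mono (subset_insert _ _))
      have h2 : (openGraph (insert g ω)).Adj v₁ a₁ := (openGraph_adj _ v₁ a₁).2 ⟨Sym2.eq_swap ▸ mem_insert _ _, hav₁.symm⟩
      have h3 : (openGraph (insert g ω)).Reachable a₁ a := (ha₁.mono (openGraph_mono (hsub.trans (subset_insert _ _)))).symm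
      exact (h1.trans h2.reachable).trans h3
  -- the second class never reaches `a` from `o`
  have hnB : ¬ (openGraph (ω ∆ N')).Reachable o a := fun h' => hao (closed (ω ∆ N') hsub' hωN' o h'.symm)
  simp only [mem_inter_iff, mem_setOf_eq, mem_compl_iff, mem_reachEv]
  constructor
  · rintro ⟨⟨-, ⟨hF, hPω⟩, hR⟩, -, hB⟩
    exact ⟨⟨⟨(hFins.1 hF).1, (hP ω hno.1).1 hPω⟩, hreach.1 hR⟩, hB.1⟩
  · rintro ⟨⟨⟨hF, hPω⟩, hR⟩, hFB, hQω⟩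
    exact ⟨⟨hno.1, ⟨hFins.2 ⟨hF, hsep⟩, (hP ω hno.1).2 hPω⟩, hreach.2 hR⟩, hno.2, ⟨hFB, hQω⟩, hnB⟩

/-- **M2 — the PENDANT-CLASS reduction of (★).**  If the pinned class of `a` (`≠ [o], [v]`) meets exactly one free pair `g = s(a₁, v₁)`, joining it
to the pinned class of `v`, and the node holds on the smaller fibre `(N ∖ g, u)` (`bad ≤ good`), then (★) holds at `(o, a)` on `(N, u)`.
[cite: SempleWelsh2008, Conj. 1.1 (p. 2); Thm. 4.2 (p. 11)] [cite: Linusson2011, Prop. 2.6] -/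
theorem hubPairOneClass_of_pendantClass (hd : Disjoint u N) (hov : o ≠ v) (hvy : v ≠ y) (heN : s(o, v) ∈ N)
    (hgN : s(a₁, v₁) ∈ N) (ha₁ : (openGraph u).Reachable a a₁) (hv₁ : (openGraph u).Reachable v v₁)
    (hav : ¬ (openGraph u).Reachable a v) (hao : ¬ (openGraph u).Reachable a o) (hay : ¬ (openGraph u).Reachable a y)
    (honly : ∀ p ∈ N, ∀ z ∈ p, (openGraph u).Reachable a z → p = s(a₁, v₁))
    (hnode : fibreCount (N \ {s(a₁, v₁)}) u (forestEv V ∩ {ω | s(o, v) ∈ ω ∧ s(o, y) ∈ ω}) (forestEv V) ≤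
      fibreCount (N \ {s(a₁, v₁)}) u (forestEv V ∩ {ω | s(o, v) ∈ ω}) (forestEv V ∩ {ω | s(o, y) ∈ ω})) :
    fibreCount N u (forestEv V ∩ {ω | s(o, v) ∈ ω ∧ s(o, y) ∈ ω} ∩ reachEv o a) (forestEv V ∩ (reachEv o a)ᶜ) +
        fibreCount N u (forestEv V ∩ reachEv o a) (forestEv V ∩ {ω | s(o, v) ∈ ω ∧ s(o, y) ∈ ω} ∩ (reachEv o a)ᶜ) ≤
      fibreCount N u (forestEv V ∩ {ω | s(o, v) ∈ ω} ∩ reachEv o a) (forestEv V ∩ {ω | s(o, y) ∈ ω} ∩ (reachEv o a)ᶜ) +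
        fibreCount N u (forestEv V ∩ {ω | s(o, y) ∈ ω} ∩ reachEv o a) (forestEv V ∩ {ω | s(o, v) ∈ ω} ∩ (reachEv o a)ᶜ) := by
  set g := s(a₁, v₁) with hgdef
  set N' := N \ {g} with hN'
  have hdN' : Disjoint u N' := hd.mono_right sdiff_subset
  -- `g ≠ e, f`
  have hge : g ≠ s(o, v) := by
    intro h'
    rcases Sym2.eq_iff.1 h' with ⟨h1, -⟩ | ⟨h1, h2⟩
    · exact hao (h1 ▸ ha₁)
    · exact hav (h1 ▸ ha₁)
  have hgf : g ≠ s(o, y) := by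
    intro h'
    rcases Sym2.eq_iff.1 h' with ⟨h1, -⟩ | ⟨h1, -⟩
    · exact hao (h1 ▸ ha₁)
    · exact hay (h1 ▸ ha₁)
  have heN' : s(o, v) ∈ N' := ⟨heN, fun h => hge (mem_singleton_iff.1 h).symm⟩
  -- insensitivity of the membership events to `g`
  have iE : ∀ ω : BondConfig V, g ∉ ω → (insert g ω ∈ {ω : BondConfig V | s(o, v) ∈ ω} ↔ ω ∈ {ω : BondConfig V | s(o, v) ∈ ω}) :=
    fun ω _ => by
      simp only [mem_setOf_eq, mem_insert_iff]
      exact ⟨fun h => h.resolve_left fun h' => hge h'.symm, Or.inr⟩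
  have iF : ∀ ω : BondConfig V, g ∉ ω → (insert g ω ∈ {ω : BondConfig V | s(o, y) ∈ ω} ↔ ω ∈ {ω : BondConfig V | s(o, y) ∈ ω}) :=
    fun ω _ => by
      simp only [mem_setOf_eq, mem_insert_iff]
      exact ⟨fun h => h.resolve_left fun h' => hgf h'.symm, Or.inr⟩
  have iEF : ∀ ω : BondConfig V, g ∉ ω →
      (insert g ω ∈ {ω : BondConfig V | s(o, v) ∈ ω ∧ s(o, y) ∈ ω} ↔ ω ∈ {ω : BondConfig V | s(o, v) ∈ ω ∧ s(o, y) ∈ ω}) :=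
    fun ω hω => by
      simp only [mem_setOf_eq]
      exact ⟨fun h => ⟨(iE ω hω).1 h.1, (iF ω hω).1 h.2⟩, fun h => ⟨(iE ω hω).2 h.1, (iF ω hω).2 h.2⟩⟩
  have iU : ∀ ω : BondConfig V, g ∉ ω → (insert g ω ∈ (univ : Set (BondConfig V)) ↔ ω ∈ (univ : Set (BondConfig V))) :=
    fun _ _ => by simp only [mem_univ]
  -- the four counts after deleting `g`
  have c1 := pendantClass_count_eq (o := o) hd hgN ha₁ hv₁ hav hao honly (univ : Set (BondConfig V)) iEF
  have c2 := pendantClass_count_eq (o := o) hd hgN ha₁ hv₁ hav hao honly {ω : BondConfig V | s(o, v) ∈ ω ∧ s(o, y) ∈ ω} iU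
  have c3 := pendantClass_count_eq (o := o) hd hgN ha₁ hv₁ hav hao honly {ω : BondConfig V | s(o, y) ∈ ω} iE
  have c4 := pendantClass_count_eq (o := o) hd hgN ha₁ hv₁ hav hao honly {ω : BondConfig V | s(o, v) ∈ ω} iF
  simp only [inter_univ] at c1 c2
  rw [c1, c2, c3, c4]
  -- notation-free bookkeeping on `(N', u)`: `R` = "`v ∈ C(o)`"
  have eR : ∀ ω : BondConfig V, ω ∈ forestEv V → s(o, v) ∈ ω → ω ∈ reachEv o v :=
    fun ω _ he => ((openGraph_adj ω o v).2 ⟨he, hov⟩).reachable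
  -- T1 = bad', T3 = good'
  have t1 : fibreCount N' u (forestEv V ∩ {ω | s(o, v) ∈ ω ∧ s(o, y) ∈ ω} ∩ reachEv o v) (forestEv V) =
      fibreCount N' u (forestEv V ∩ {ω | s(o, v) ∈ ω ∧ s(o, y) ∈ ω}) (forestEv V) :=
    fibreCount_congr_fibre N' u fun ω _ => by
      simp only [mem_inter_iff, mem_setOf_eq]
      exact ⟨fun h => ⟨⟨h.1.1.1, h.1.1.2⟩, h.2⟩, fun h => ⟨⟨⟨h.1.1, h.1.2⟩, eR ω h.1.1 h.1.2.1⟩, h.2⟩⟩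
  have t3 : fibreCount N' u (forestEv V ∩ {ω | s(o, v) ∈ ω} ∩ reachEv o v) (forestEv V ∩ {ω | s(o, y) ∈ ω}) =
      fibreCount N' u (forestEv V ∩ {ω | s(o, v) ∈ ω}) (forestEv V ∩ {ω | s(o, y) ∈ ω}) :=
    fibreCount_congr_fibre N' u fun ω _ => by
      simp only [mem_inter_iff, mem_setOf_eq]
      exact ⟨fun h => ⟨⟨h.1.1.1, h.1.1.2⟩, h.2⟩, fun h => ⟨⟨⟨h.1.1, h.1.2⟩, eR ω h.1.1 h.1.2⟩, h.2⟩⟩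
  -- T2, T4 are the type-AB(o,v) counts `sRR_AB`, `dRB_AB` (swap)
  have t2 : fibreCount N' u (forestEv V ∩ reachEv o v) (forestEv V ∩ {ω | s(o, v) ∈ ω ∧ s(o, y) ∈ ω}) =
      fibreCount N' u (forestEv V ∩ {ω | s(o, v) ∈ ω ∧ s(o, y) ∈ ω} ∩ reachEv o v) (forestEv V ∩ reachEv o v) := by
    rw [fibreCount_swap N' u (forestEv V ∩ {ω | s(o, v) ∈ ω ∧ s(o, y) ∈ ω} ∩ reachEv o v)]
    exact fibreCount_congr_fibre N' u fun ω _ => by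
      simp only [mem_inter_iff, mem_setOf_eq]
      exact ⟨fun h => ⟨h.1, ⟨h.2.1, h.2.2⟩, eR _ h.2.1 h.2.2.1⟩, fun h => ⟨h.1, h.2.1.1, h.2.1.2⟩⟩
  have t4 : fibreCount N' u (forestEv V ∩ {ω | s(o, y) ∈ ω} ∩ reachEv o v) (forestEv V ∩ {ω | s(o, v) ∈ ω}) =
      fibreCount N' u (forestEv V ∩ {ω | s(o, v) ∈ ω} ∩ reachEv o v) (forestEv V ∩ {ω | s(o, y) ∈ ω} ∩ reachEv o v) := by
    rw [fibreCount_swap N' u (forestEv V ∩ {ω | s(o, v) ∈ ω} ∩ reachEv o v)]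
    exact fibreCount_congr_fibre N' u fun ω _ => by
      simp only [mem_inter_iff, mem_setOf_eq]
      exact ⟨fun h => ⟨h.1, h.2, eR _ h.2.1 h.2.2⟩, fun h => ⟨h.1, h.2.1⟩⟩
  -- bad' and good' split by `R` in the second class; the `Rᶜ` parts are equal (F3)
  have hdisj : Disjoint (forestEv V ∩ (reachEv o v)ᶜ) (forestEv V ∩ reachEv o v) :=
    Set.disjoint_left.2 fun ω h₁ h₂ => h₁.2 h₂.2
  have hFo : forestEv V = (forestEv V ∩ (reachEv o v)ᶜ) ∪ (forestEv V ∩ reachEv o v) := by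
    rw [← inter_union_distrib_left, compl_union_self, inter_univ]
  have hFoF : forestEv V ∩ {ω : BondConfig V | s(o, y) ∈ ω} =
      (forestEv V ∩ {ω | s(o, y) ∈ ω} ∩ (reachEv o v)ᶜ) ∪ (forestEv V ∩ {ω | s(o, y) ∈ ω} ∩ reachEv o v) := by
    rw [← inter_union_distrib_left, compl_union_self, inter_univ]
  have hdisjF : Disjoint (forestEv V ∩ {ω : BondConfig V | s(o, y) ∈ ω} ∩ (reachEv o v)ᶜ) (forestEv V ∩ {ω | s(o, y) ∈ ω} ∩ reachEv o v) :=
    Set.disjoint_left.2 fun ω h₁ h₂ => h₁.2 h₂.2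
  have sb : fibreCount N' u (forestEv V ∩ {ω | s(o, v) ∈ ω ∧ s(o, y) ∈ ω}) (forestEv V) =
      fibreCount N' u (forestEv V ∩ {ω | s(o, v) ∈ ω ∧ s(o, y) ∈ ω} ∩ reachEv o v) (forestEv V ∩ (reachEv o v)ᶜ) +
        fibreCount N' u (forestEv V ∩ {ω | s(o, v) ∈ ω ∧ s(o, y) ∈ ω} ∩ reachEv o v) (forestEv V ∩ reachEv o v) := by
    rw [← t1, ← fibreCount_split_right N' u _ hdisj, ← hFo]
  have sg : fibreCount N' u (forestEv V ∩ {ω | s(o, v) ∈ ω}) (forestEv V ∩ {ω | s(o, y) ∈ ω}) =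
      fibreCount N' u (forestEv V ∩ {ω | s(o, v) ∈ ω} ∩ reachEv o v) (forestEv V ∩ {ω | s(o, y) ∈ ω} ∩ (reachEv o v)ᶜ) +
        fibreCount N' u (forestEv V ∩ {ω | s(o, v) ∈ ω} ∩ reachEv o v) (forestEv V ∩ {ω | s(o, y) ∈ ω} ∩ reachEv o v) := by
    rw [← t3, ← fibreCount_split_right N' u _ hdisjF, ← hFoF]
  have F3 : fibreCount N' u (forestEv V ∩ {ω | s(o, v) ∈ ω ∧ s(o, y) ∈ ω} ∩ reachEv o v) (forestEv V ∩ (reachEv o v)ᶜ) =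
      fibreCount N' u (forestEv V ∩ {ω | s(o, v) ∈ ω} ∩ reachEv o v) (forestEv V ∩ {ω | s(o, y) ∈ ω} ∩ (reachEv o v)ᶜ) :=
    hubPair_sRR_eq_dRB_at_v hdN' hov hvy heN'
  rw [t1, t2, t3, t4]
  rw [sb, sg, F3] at hnode
  rw [sb, sg, F3]
  omega

end Pendant

end FK
end Summit.CriticalPhenomena.PercolationContinuityZ3.Theorems

end
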